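import Literature.AlgebraicGeometry.Resolution.RegularLocalRingsFlatDescent
import Literature.AlgebraicGeometry.Morphisms.FlatOfFlatFibresLocalBase
import Summits.ResolutionOfSingularities.ResolutionOfSingularities.Theorems.FrobeniusLadderFRationalResolutionHomogeneousUnits
import Mathlib.RingTheory.Flat.Localization
import HarnessLib

/-!
# Crux `FrobeniusLadder.FRationalResolution` (stmt-ResolutionOfSingularities-15317), line `redirect`,
# stub `stub_diagonalizableQuotientResolution` — regularity DESCENDS along flat algebras prime by
# prime, and a graded algebra with homogeneous units on its support is free over degree zero
# (step (e) bricks of the Kato-(7.1)-at-fixed-points plan, memo MEMO-15317-leafhand2-g3 §6)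

Step (e) compares the Kato quotient `(S₀)_𝔮'/K_I` with the regular stratum `S_𝔔'/(x_I)`: the
stratum ring `T = S_g/(x_I)` is graded, generated over `T₀` by monomials in the surviving
parameters, which are UNITS near `𝔔'`; so `T` is free over `T₀` there and regularity of `T_𝔔̄'`
descends to `(T₀)_𝔮̄'`. This file supplies the two generic ingredients:

* **`isRegularLocalRing_atPrime_of_flat`** — for a flat algebra `B → B'` with `B` Noetherian and a
  prime `q'` of `B'` over `q`: `B'_{q'}` regular ⇒ `B_q` regular (Matsumura 23.7 (i), tree's
  `IsRegularLocalRing.of_flat_ringHom`, along the flat local homomorphism `B_q → B'_{q'}`,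
  tree's `flat_localRingHom_of_flat`);
* **`exists_basis_of_units_on_support`** — a graded algebra `T = ⊕_b T_b` such that every degree
  `b` either carries a homogeneous UNIT `u_b` or has `T_b = 0` is FREE over `T₀` on the units
  (generalises `…HomogeneousUnits.exists_basis_of_homogeneous_units`, which needs a unit in EVERY
  degree); `free_of_units_on_support`, `flat_of_units_on_support`.

Honest label: generic bricks (no stub closed). No definitions, no named facts, no sorry.
[cite: Matsumura1987, Thm. 23.7 (i)] [folklore; cite: SGA3, Exp. VIII §4–5]
-/

noncomputable section

-- single-problem summit: the doubled namespace component is forced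
set_option linter.dupNamespace false

open IsLocalRing DirectSum Literature.AlgebraicGeometry.Resolution
open Literature.AlgebraicGeometry.Morphisms

namespace Summit.ResolutionOfSingularities.ResolutionOfSingularities.Theorems.FRationalResolution.FlatPrimeDescent

universe u v w

/-- **Regularity descends along flat algebras, prime by prime** (Matsumura 23.7 (i)): if `B'` is a
flat `B`-algebra, `B` is Noetherian, `q'` is a prime of `B'` lying over `q`, and `B'_{q'}` is a
regular local ring, then so is `B_q`. [cite: Matsumura1987, Thm. 23.7 (i)] -/
theorem isRegularLocalRing_atPrime_of_flat {B B' : Type u} [CommRing B] [CommRing B'] [Algebra B B']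
    [IsNoetherianRing B] [Module.Flat B B'] (q' : Ideal B') [q'.IsPrime] (q : Ideal B) [q.IsPrime]
    (hq : q = q'.comap (algebraMap B B')) [IsRegularLocalRing (Localization.AtPrime q')] :
    IsRegularLocalRing (Localization.AtPrime q) := by
  haveI : Module.Flat B (Localization.AtPrime q') :=
    Module.Flat.trans B B' (Localization.AtPrime q')
  have hflat := flat_localRingHom_of_flat q' q hq inferInstance
  exact IsRegularLocalRing.of_flat_ringHom (Localization.localRingHom q q' (algebraMap B B') hq) hflat

section Graded

variable {k : Type u} [CommRing k] {B : Type w} [DecidableEq B] [AddCommGroup B] {T : Type v}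
  [CommRing T] [Algebra k T] (𝒯 : B → Submodule k T) [GradedAlgebra 𝒯]

/-- **Free over degree zero on the units of the support.** Let `T = ⊕_b T_b` be graded and `D ⊆ B`
a set of degrees with a homogeneous UNIT `u_b ∈ T_b` for every `b ∈ D` and `T_b = 0` for every
`b ∉ D`. Then `(u_b)_{b ∈ D}` is a `T₀`-basis of `T`. [folklore; cite: SGA3, Exp. VIII §4–5] -/
theorem exists_basis_of_units_on_support (D : Set B) (u : B → T) (hu : ∀ b ∈ D, u b ∈ 𝒯 b)
    (hunit : ∀ b ∈ D, IsUnit (u b)) (hzero : ∀ b ∉ D, 𝒯 b = ⊥) :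
    ∃ basis : Module.Basis D (𝒯 0) T, ∀ b : D, basis b = u b := by
  classical
  have hinv : ∀ b : D, ∃ v : T, u b * v = 1 := fun b => (hunit b b.2).exists_right_inv
  choose v hv using hinv
  -- linear independence: project a relation to each degree
  have hli : LinearIndependent (𝒯 0) (fun b : D => u b) := by
    rw [linearIndependent_iff']
    intro s r hsum b hb
    have hcomp : ∀ c ∈ s, (decompose 𝒯 (r c • u c) (b : B) : T) =
        if c = b then (r b : T) * u b else 0 := by
      intro c _
      have hmem : (r c : T) * u c ∈ 𝒯 (c : B) := by
        have h := SetLike.mul_mem_graded (r c).2 (hu c c.2)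
        rwa [zero_add] at h
      rw [Algebra.smul_def, show algebraMap (𝒯 0) T (r c) = (r c : T) from rfl]
      by_cases hcb : c = b
      · subst hcb
        rw [if_pos rfl, decompose_of_mem_same 𝒯 hmem]
      · rw [if_neg hcb, decompose_of_mem_ne 𝒯 hmem (fun h => hcb (Subtype.ext h))]
    have hproj : ∑ c ∈ s, (decompose 𝒯 (r c • u c) (b : B) : T) = 0 := by
      have h := congrArg (GradedRing.proj 𝒯 (b : B)) hsum
      rw [map_sum, map_zero] at h
      simpa only [GradedRing.proj_apply] using h
    rw [Finset.sum_congr rfl hcomp, Finset.sum_ite_eq' s b, if_pos hb] at hproj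
    have hrb : (r b : T) = 0 := by
      have h := congrArg (· * v b) hproj
      simpa [mul_assoc, hv b] using h
    exact Subtype.ext hrb
  -- spanning: `t = Σ_b t_b`, `t_b = (t_b v_b) • u_b` for `b ∈ D`, `t_b = 0` otherwise
  have hsp : ⊤ ≤ Submodule.span (𝒯 0) (Set.range fun b : D => u b) := by
    rintro t -
    rw [← sum_support_decompose 𝒯 t]
    refine Submodule.sum_mem _ fun b _ => ?_
    by_cases hbD : b ∈ D
    · have hvdeg : v ⟨b, hbD⟩ ∈ 𝒯 (-b) :=
        HomogeneousUnits.inv_mem_of_isUnit 𝒯 (hu b hbD) (hv ⟨b, hbD⟩)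
      obtain ⟨r, hr, hrb⟩ :=
        (HomogeneousUnits.mem_grade_iff_exists_mul_unit 𝒯 (hu b hbD) (hv ⟨b, hbD⟩) _).mp
          (decompose 𝒯 t b).2
      rw [hrb, show r * u b = (⟨r, hr⟩ : 𝒯 0) • u b from by rw [Algebra.smul_def]; rfl]
      exact Submodule.smul_mem _ _ (Submodule.subset_span ⟨⟨b, hbD⟩, rfl⟩)
    · have h0 : (decompose 𝒯 t b : T) = 0 := by
        have hmem : (decompose 𝒯 t b : T) ∈ 𝒯 b := (decompose 𝒯 t b).2
        have hle : 𝒯 b ≤ ⊥ := (hzero b hbD).le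
        exact (Submodule.mem_bot (R := k)).mp (hle hmem)
      rw [h0]
      exact Submodule.zero_mem _
  exact ⟨Module.Basis.mk hli hsp, fun b => Module.Basis.mk_apply hli hsp b⟩

/-- Hence `T` is a FREE `T₀`-module. [folklore; cite: SGA3, Exp. VIII §4–5] -/
theorem free_of_units_on_support (D : Set B) (u : B → T) (hu : ∀ b ∈ D, u b ∈ 𝒯 b)
    (hunit : ∀ b ∈ D, IsUnit (u b)) (hzero : ∀ b ∉ D, 𝒯 b = ⊥) : Module.Free (𝒯 0) T := by
  obtain ⟨basis, -⟩ := exists_basis_of_units_on_support 𝒯 D u hu hunit hzero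
  exact Module.Free.of_basis basis

/-- Hence `T` is FLAT over `T₀` (so regularity descends from `T` to `T₀` prime by prime,
`isRegularLocalRing_atPrime_of_flat`). [folklore; cite: SGA3, Exp. VIII §4–5] -/
theorem flat_of_units_on_support (D : Set B) (u : B → T) (hu : ∀ b ∈ D, u b ∈ 𝒯 b)
    (hunit : ∀ b ∈ D, IsUnit (u b)) (hzero : ∀ b ∉ D, 𝒯 b = ⊥) : Module.Flat (𝒯 0) T := by
  haveI := free_of_units_on_support 𝒯 D u hu hunit hzero
  infer_instance

end Graded

end Summit.ResolutionOfSingularities.ResolutionOfSingularities.Theorems.FRationalResolution.FlatPrimeDescent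

end
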